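import Mathlib
import Summits.KontsevichZagierPeriods.Zeta5Search.Families.RayGrowthRealTransport
import HarnessLib

/-!
# ζ(5) search — Families: the exactness certificate for RAYS — weighted scaling equations `Σ_{e ∋ w} β_e g_w/len_e = α_w ⇒ F(t) = M_σ(α,β)`

HONEST FRAMING: systematic search; no irrationality claim unless certified.  STRUCTURAL facts about the size of
Brown's generalised cellular integrals along a ray `N ↦ f_σ(Nα,Nβ) ω_σ` [Brown2016, §5.2; BrownZudilin2022, (1)–(3)]
(seat P2, Families layer); nothing about the arithmetic of any zeta value.

With the real weighted weak duality of `Families/RayGrowthRealTransport.lean`: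
* the WEIGHTED plan of a point, `rayPointPlan (i,w) = β_i g_w/len_i`, and the **weighted scaling equations**
  `IsRayScaling : ∀ w, Σ_{e ∋ w} β_e g_w/len_e = α_w` (row sums `β_i` automatic, column sums `α_w` = the equations);
* `rayF_eq_exp` (`F = exp(Σ α log g − Σ β log len)`), `prod_rayPointPlan_rpow` — at a weighted scaling point
  `∏ x^x = F(t) ∏_i β_i^{β_i}`;
* **`rayF_eq_raySup_of_isRayScaling`** / **`raySup_eq_of_isRayScaling`** — EXACTNESS CERTIFICATE: for a bijective
  seating, a homogeneous ray in Brown's cone with `β > 0` on the finite edges, a point of the open simplex satisfying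
  the weighted scaling equations realises the growth constant: `F(t) = M_σ(α,β)`.  So the decay base `bzSup a` of every
  Brown–Zudilin direction is pinned by `ℓ + 1` identities at one algebraic point.
Standard axioms only.
-/

noncomputable section

open MeasureTheory Set Finset Filter Topology

namespace Summit.KontsevichZagierPeriods.Zeta5Search.Families.Cellular

variable {ℓ : ℕ} (σ : Fin (ℓ + 3) → Fin (ℓ + 3)) (α β : Fin (ℓ + 3) → ℤ)

/-! ### The weighted plan of a point and the weighted scaling equations -/

/-- The weighted transport plan of the point `t`: `x(i,w) = β_i g_w / len_i` on (finite edge `i`, `w ∈ span i`). -/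
def rayPointPlan (hσi : Function.Injective σ) (t : Fin ℓ → ℝ) : Fin (ℓ + 3) → Fin (ℓ + 1) → ℝ := fun i w =>
  if h : (σ i).val ≠ ℓ + 2 ∧ (σ (i + 1)).val ≠ ℓ + 2 then
    (if w ∈ (cellEdges σ hσi).span (Sum.inr ⟨i, h⟩)
      then (β i : ℝ) * gapN t w / (cellEdges σ hσi).len t (Sum.inr ⟨i, h⟩) else 0)
  else 0

/-- **The weighted scaling equations** of the ray at `t`: `Σ_{e ∋ w} β_e gapN t w / len_t(e) = α_w` for every gap. -/
def IsRayScaling (hσi : Function.Injective σ) (t : Fin ℓ → ℝ) : Prop :=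
  ∀ w : Fin (ℓ + 1), ∑ e ∈ univ.filter (fun e : SEdge σ => w ∈ (cellEdges σ hσi).span (Sum.inr e)),
    (β e.1 : ℝ) * gapN t w / (cellEdges σ hσi).len t (Sum.inr e) = (α ⟨w.val, by omega⟩ : ℝ)

variable {σ α β}
variable (hσi : Function.Injective σ)

/-- The weighted plan at a finite edge. -/
theorem rayPointPlan_of_finite (t : Fin ℓ → ℝ) (i : Fin (ℓ + 3))
    (h : (σ i).val ≠ ℓ + 2 ∧ (σ (i + 1)).val ≠ ℓ + 2) (w : Fin (ℓ + 1)) :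
    rayPointPlan σ β hσi t i w = if w ∈ (cellEdges σ hσi).span (Sum.inr ⟨i, h⟩)
      then (β i : ℝ) * gapN t w / (cellEdges σ hσi).len t (Sum.inr ⟨i, h⟩) else 0 := by
  simp [rayPointPlan, h]

/-- The weighted plan vanishes at the positions adjacent to `∞`. -/
theorem rayPointPlan_of_infinite (t : Fin ℓ → ℝ) (i : Fin (ℓ + 3))
    (h : ¬ ((σ i).val ≠ ℓ + 2 ∧ (σ (i + 1)).val ≠ ℓ + 2)) (w : Fin (ℓ + 1)) : rayPointPlan σ β hσi t i w = 0 := by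
  simp only [rayPointPlan, dif_neg h]

/-- Non-negativity of the weighted plan when `β ≥ 0` on the finite edges. -/
theorem rayPointPlan_nonneg (hβ : ∀ i, ((σ i).val ≠ ℓ + 2 ∧ (σ (i + 1)).val ≠ ℓ + 2) → 0 ≤ β i)
    {t : Fin ℓ → ℝ} (ht : t ∈ openSimplex ℓ) (i : Fin (ℓ + 3)) (w : Fin (ℓ + 1)) :
    0 ≤ rayPointPlan σ β hσi t i w := by
  unfold rayPointPlan
  split_ifs with h hw
  · exact div_nonneg (mul_nonneg (by exact_mod_cast hβ i h) ((mem_openSimplex_iff_gapN t).1 ht w).le)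
      ((cellEdges σ hσi).len_pos ht _).le
  · exact le_rfl
  · exact le_rfl

/-- Support of the weighted plan. -/
theorem rayPointPlan_supp (t : Fin ℓ → ℝ) (i : Fin (ℓ + 3)) (w : Fin (ℓ + 1))
    (hx : rayPointPlan σ β hσi t i w ≠ 0) :
    ((σ i).val ≠ ℓ + 2 ∧ (σ (i + 1)).val ≠ ℓ + 2) ∧
      min (σ i).val (σ (i + 1)).val ≤ w.val ∧ w.val < max (σ i).val (σ (i + 1)).val := by
  unfold rayPointPlan at hx
  split_ifs at hx with h hw
  · refine ⟨h, ?_⟩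
    rw [EdgeFamily.mem_span] at hw
    simpa [cellEdges] using hw
  · exact absurd rfl hx
  · exact absurd rfl hx

/-- Row sums of the weighted plan: `Σ_w x(i,w) = β_i` at every finite edge. -/
theorem rayPointPlan_row {t : Fin ℓ → ℝ} (ht : t ∈ openSimplex ℓ) (i : Fin (ℓ + 3))
    (h : (σ i).val ≠ ℓ + 2 ∧ (σ (i + 1)).val ≠ ℓ + 2) : ∑ w, rayPointPlan σ β hσi t i w = β i := by
  simp only [rayPointPlan_of_finite hσi t i h]
  rw [Finset.sum_ite_mem, Finset.univ_inter]
  simp only [mul_div_assoc]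
  rw [← Finset.mul_sum, ← Finset.sum_div, ← (cellEdges σ hσi).len_eq_sum_gap,
    div_self ((cellEdges σ hσi).len_pos ht _).ne', mul_one]

/-- Column sums of the weighted plan are the weighted scaling sums. -/
theorem sum_rayPointPlan_col (t : Fin ℓ → ℝ) (w : Fin (ℓ + 1)) :
    ∑ i, rayPointPlan σ β hσi t i w =
      ∑ e ∈ univ.filter (fun e : SEdge σ => w ∈ (cellEdges σ hσi).span (Sum.inr e)),
        (β e.1 : ℝ) * gapN t w / (cellEdges σ hσi).len t (Sum.inr e) := by
  rw [Finset.sum_filter]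
  unfold rayPointPlan
  exact sum_pos_eq_sum_sEdge σ (fun e => if w ∈ (cellEdges σ hσi).span (Sum.inr e)
    then (β e.1 : ℝ) * gapN t w / (cellEdges σ hσi).len t (Sum.inr e) else 0)

/-- Column sums `= α_w` under the weighted scaling equations. -/
theorem rayPointPlan_col {t : Fin ℓ → ℝ} (hS : IsRayScaling σ α β hσi t) (w : Fin (ℓ + 1)) :
    ∑ i, rayPointPlan σ β hσi t i w = α ⟨w.val, by omega⟩ := by
  rw [sum_rayPointPlan_col]; exact hS w

/-! ### The value of the entropy bound at a weighted scaling point -/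

/-- `F(t) = exp(Σ_w α_w log g_w − Σ_e β_e log len_e)` on the open simplex (bijective seating). -/
theorem rayF_eq_exp (hσ : Function.Bijective σ) {t : Fin ℓ → ℝ} (ht : t ∈ openSimplex ℓ) :
    rayF σ α β t = Real.exp ((∑ w : Fin (ℓ + 1), (α ⟨w.val, by omega⟩ : ℝ) * Real.log (gapN t w)) -
      ∑ e : SEdge σ, (β e.1 : ℝ) * Real.log ((cellEdges σ hσ.1).len t (Sum.inr e))) := by
  have hpos := (mem_openSimplex_iff_gapN t).1 ht
  have hLpos : ∀ i, 0 < ef t (σ i) (σ (i + 1)) := fun i => ef_pos ht fun h => succ_ne_self i (hσ.1 h)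
  have hnum : num α t = Real.exp (∑ w : Fin (ℓ + 1), (α ⟨w.val, by omega⟩ : ℝ) * Real.log (gapN t w)) := by
    rw [num_eq_prod_gapN_zpow, Real.exp_sum]
    refine Finset.prod_congr rfl fun w _ => ?_
    rw [← Real.rpow_intCast, Real.rpow_def_of_pos (hpos w), mul_comm]
  have hden : den σ β t = Real.exp (∑ e : SEdge σ, (β e.1 : ℝ) * Real.log ((cellEdges σ hσ.1).len t (Sum.inr e))) := by
    have h1 : den σ β t = ∏ i, Real.exp (if h : (σ i).val ≠ ℓ + 2 ∧ (σ (i + 1)).val ≠ ℓ + 2 then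
        (β i : ℝ) * Real.log ((cellEdges σ hσ.1).len t (Sum.inr ⟨i, h⟩)) else 0) := by
      unfold den
      refine Finset.prod_congr rfl fun i _ => ?_
      by_cases hfin : (σ i).val ≠ ℓ + 2 ∧ (σ (i + 1)).val ≠ ℓ + 2
      · rw [dif_pos hfin, ← Real.rpow_intCast, Real.rpow_def_of_pos (hLpos i), mul_comm]
        congr 2
        rw [ef_sigma_of_finite σ t i hfin]
        rfl
      · rw [dif_neg hfin, Real.exp_zero, ef_sigma_of_infinite σ t i hfin, one_zpow]
    rw [h1, ← Real.exp_sum]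
    congr 1
    exact sum_pos_eq_sum_sEdge σ (fun e => (β e.1 : ℝ) * Real.log ((cellEdges σ hσ.1).len t (Sum.inr e)))
  unfold rayF
  rw [hnum, hden, ← Real.exp_sub]

/-- **`∏ x^x = F(t) · ∏_i (Σ_w x)^{Σ_w x}`** for the weighted plan of a weighted scaling point (`β > 0` on the finite
edges). -/
theorem prod_rayPointPlan_rpow (hσ : Function.Bijective σ)
    (hβ : ∀ i, ((σ i).val ≠ ℓ + 2 ∧ (σ (i + 1)).val ≠ ℓ + 2) → 0 < β i)
    {t : Fin ℓ → ℝ} (ht : t ∈ openSimplex ℓ) (hS : IsRayScaling σ α β hσ.1 t) :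
    ∏ i, ∏ w, rayPointPlan σ β hσ.1 t i w ^ rayPointPlan σ β hσ.1 t i w =
      rayF σ α β t * ∏ i, (∑ w, rayPointPlan σ β hσ.1 t i w) ^ (∑ w, rayPointPlan σ β hσ.1 t i w) := by
  classical
  set E := cellEdges σ hσ.1 with hE
  have hpos := (mem_openSimplex_iff_gapN t).1 ht
  have hlen : ∀ e : SEdge σ, 0 < E.len t (Sum.inr e) := fun e => E.len_pos ht _
  -- (1) the left-hand side as an exponential of a double sum
  have hfin : ∀ (i : Fin (ℓ + 3)) (h : (σ i).val ≠ ℓ + 2 ∧ (σ (i + 1)).val ≠ ℓ + 2),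
      ∏ w, rayPointPlan σ β hσ.1 t i w ^ rayPointPlan σ β hσ.1 t i w =
        Real.exp (∑ w ∈ E.span (Sum.inr ⟨i, h⟩), ((β i : ℝ) * gapN t w / E.len t (Sum.inr ⟨i, h⟩)) *
          (Real.log (β i : ℝ) + Real.log (gapN t w) - Real.log (E.len t (Sum.inr ⟨i, h⟩)))) := by
    intro i h
    have hb : (0 : ℝ) < β i := by exact_mod_cast hβ i h
    rw [Real.exp_sum, ← Finset.prod_filter_mul_prod_filter_not univ (fun w => w ∈ E.span (Sum.inr ⟨i, h⟩))]
    have h2 : ∏ w ∈ univ.filter (fun w => ¬ w ∈ E.span (Sum.inr ⟨i, h⟩)),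
        rayPointPlan σ β hσ.1 t i w ^ rayPointPlan σ β hσ.1 t i w = 1 :=
      Finset.prod_eq_one fun w hw => by
        rw [Finset.mem_filter] at hw
        rw [rayPointPlan_of_finite hσ.1 t i h, if_neg hw.2, Real.rpow_zero]
    rw [h2, mul_one, Finset.filter_mem_eq_inter, Finset.univ_inter]
    refine Finset.prod_congr rfl fun w hw => ?_
    have hxpos : 0 < (β i : ℝ) * gapN t w / E.len t (Sum.inr ⟨i, h⟩) := div_pos (mul_pos hb (hpos w)) (hlen _)
    rw [rayPointPlan_of_finite hσ.1 t i h, if_pos hw, Real.rpow_def_of_pos hxpos,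
      Real.log_div (mul_pos hb (hpos w)).ne' (hlen _).ne', Real.log_mul hb.ne' (hpos w).ne', mul_comm]
  have hinf : ∀ (i : Fin (ℓ + 3)), ¬ ((σ i).val ≠ ℓ + 2 ∧ (σ (i + 1)).val ≠ ℓ + 2) →
      ∏ w, rayPointPlan σ β hσ.1 t i w ^ rayPointPlan σ β hσ.1 t i w = 1 := fun i h =>
    Finset.prod_eq_one fun w _ => by rw [rayPointPlan_of_infinite hσ.1 t i h, Real.rpow_zero]
  have hstep : ∀ i : Fin (ℓ + 3), ∏ w, rayPointPlan σ β hσ.1 t i w ^ rayPointPlan σ β hσ.1 t i w =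
      Real.exp (if h : (σ i).val ≠ ℓ + 2 ∧ (σ (i + 1)).val ≠ ℓ + 2 then
        ∑ w ∈ E.span (Sum.inr ⟨i, h⟩), ((β i : ℝ) * gapN t w / E.len t (Sum.inr ⟨i, h⟩)) *
          (Real.log (β i : ℝ) + Real.log (gapN t w) - Real.log (E.len t (Sum.inr ⟨i, h⟩))) else 0) := by
    intro i
    by_cases h : (σ i).val ≠ ℓ + 2 ∧ (σ (i + 1)).val ≠ ℓ + 2
    · rw [dif_pos h, hfin i h]
    · rw [dif_neg h, Real.exp_zero, hinf i h]
  simp only [hstep]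
  have hsum := sum_pos_eq_sum_sEdge σ (fun e : SEdge σ => ∑ w ∈ E.span (Sum.inr e),
    ((β e.1 : ℝ) * gapN t w / E.len t (Sum.inr e)) *
      (Real.log (β e.1 : ℝ) + Real.log (gapN t w) - Real.log (E.len t (Sum.inr e))))
  beta_reduce at hsum
  rw [← Real.exp_sum, hsum]
  -- (2) the factor `∏_i (Σ_w x)^{Σ_w x} = exp (Σ_e β_e log β_e)`
  have hX : ∏ i, (∑ w, rayPointPlan σ β hσ.1 t i w) ^ (∑ w, rayPointPlan σ β hσ.1 t i w) =
      Real.exp (∑ e : SEdge σ, (β e.1 : ℝ) * Real.log (β e.1 : ℝ)) := by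
    have h1 : ∀ i, (∑ w, rayPointPlan σ β hσ.1 t i w) ^ (∑ w, rayPointPlan σ β hσ.1 t i w) =
        Real.exp (if h : (σ i).val ≠ ℓ + 2 ∧ (σ (i + 1)).val ≠ ℓ + 2 then (β i : ℝ) * Real.log (β i : ℝ)
          else 0) := by
      intro i
      by_cases h : (σ i).val ≠ ℓ + 2 ∧ (σ (i + 1)).val ≠ ℓ + 2
      · have hb : (0 : ℝ) < β i := by exact_mod_cast hβ i h
        rw [dif_pos h, rayPointPlan_row hσ.1 ht i h, Real.rpow_def_of_pos hb, mul_comm]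
      · have h0 : ∑ w, rayPointPlan σ β hσ.1 t i w = 0 :=
          Finset.sum_eq_zero fun w _ => rayPointPlan_of_infinite hσ.1 t i h w
        rw [dif_neg h, h0, Real.rpow_zero, Real.exp_zero]
    simp only [h1]
    rw [← Real.exp_sum]
    congr 1
    exact sum_pos_eq_sum_sEdge σ (fun e : SEdge σ => (β e.1 : ℝ) * Real.log (β e.1 : ℝ))
  rw [hX, rayF_eq_exp hσ ht, ← Real.exp_add]
  congr 1
  -- (3) the exponents agree: split the double sum into three parts and use the two marginal identities
  have hsplit : ∑ e : SEdge σ, ∑ w ∈ E.span (Sum.inr e), ((β e.1 : ℝ) * gapN t w / E.len t (Sum.inr e)) *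
      (Real.log (β e.1 : ℝ) + Real.log (gapN t w) - Real.log (E.len t (Sum.inr e))) =
      (∑ e : SEdge σ, ∑ w ∈ E.span (Sum.inr e), ((β e.1 : ℝ) * gapN t w / E.len t (Sum.inr e)) *
        Real.log (β e.1 : ℝ)) +
      (∑ e : SEdge σ, ∑ w ∈ E.span (Sum.inr e), ((β e.1 : ℝ) * gapN t w / E.len t (Sum.inr e)) *
        Real.log (gapN t w)) -
      ∑ e : SEdge σ, ∑ w ∈ E.span (Sum.inr e), ((β e.1 : ℝ) * gapN t w / E.len t (Sum.inr e)) *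
        Real.log (E.len t (Sum.inr e)) := by
    rw [← Finset.sum_add_distrib, ← Finset.sum_sub_distrib]
    refine Finset.sum_congr rfl fun e _ => ?_
    rw [← Finset.sum_add_distrib, ← Finset.sum_sub_distrib]
    refine Finset.sum_congr rfl fun w _ => ?_
    ring
  -- row identity: `Σ_{w ∈ span e} β g_w/len_e = β`
  have hrowid : ∀ e : SEdge σ, ∑ w ∈ E.span (Sum.inr e), (β e.1 : ℝ) * gapN t w / E.len t (Sum.inr e) = β e.1 := by
    intro e
    simp only [mul_div_assoc]
    rw [← Finset.mul_sum, ← Finset.sum_div, ← E.len_eq_sum_gap, div_self (hlen e).ne', mul_one]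
  have hA : ∑ e : SEdge σ, ∑ w ∈ E.span (Sum.inr e), ((β e.1 : ℝ) * gapN t w / E.len t (Sum.inr e)) *
      Real.log (β e.1 : ℝ) = ∑ e : SEdge σ, (β e.1 : ℝ) * Real.log (β e.1 : ℝ) := by
    refine Finset.sum_congr rfl fun e _ => ?_
    rw [← Finset.sum_mul, hrowid e]
  have hB : ∑ e : SEdge σ, ∑ w ∈ E.span (Sum.inr e), ((β e.1 : ℝ) * gapN t w / E.len t (Sum.inr e)) *
      Real.log (gapN t w) = ∑ w : Fin (ℓ + 1), (α ⟨w.val, by omega⟩ : ℝ) * Real.log (gapN t w) := by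
    rw [sum_sEdge_sum_span_comm σ hσ.1]
    refine Finset.sum_congr rfl fun w _ => ?_
    rw [← Finset.sum_mul, hS w]
  have hC : ∑ e : SEdge σ, ∑ w ∈ E.span (Sum.inr e), ((β e.1 : ℝ) * gapN t w / E.len t (Sum.inr e)) *
      Real.log (E.len t (Sum.inr e)) = ∑ e : SEdge σ, (β e.1 : ℝ) * Real.log (E.len t (Sum.inr e)) := by
    refine Finset.sum_congr rfl fun e _ => ?_
    rw [← Finset.sum_mul, hrowid e]
  rw [hsplit, hA, hB, hC]
  ring

/-! ### The exactness certificate for rays -/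

variable (σ α β) in
/-- **Exactness certificate for rays.**  For a bijective seating, a homogeneous ray `(α, β)` in Brown's cone with
`β > 0` on the finite `σδ⁰`-edges, and a point of the open simplex satisfying the weighted scaling equations:
`F(t) = M_σ(α,β)`. -/
theorem rayF_eq_raySup_of_isRayScaling (hσ : Function.Bijective σ) (hh : Homogeneous σ α β)
    (hray : ∀ N : ℤ, 0 ≤ N → BrownConvergent σ (fun i => N * α i) (fun i => N * β i))
    (hβ : ∀ i, ((σ i).val ≠ ℓ + 2 ∧ (σ (i + 1)).val ≠ ℓ + 2) → 0 < β i)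
    {t : Fin ℓ → ℝ} (ht : t ∈ openSimplex ℓ) (hS : IsRayScaling σ α β hσ.1 t) :
    rayF σ α β t = raySup σ α β := by
  refine le_antisymm (rayF_le_raySup σ α β hσ hh hray ht) ?_
  set x := rayPointPlan σ β hσ.1 t with hxdef
  have hx0 : ∀ i w, 0 ≤ x i w := fun i w => rayPointPlan_nonneg hσ.1 (fun i h => (hβ i h).le) ht i w
  have hw := raySup_mul_le_of_realTransport σ α β hσ x hx0 (rayPointPlan_supp hσ.1 t)
    (rayPointPlan_row hσ.1 ht) (rayPointPlan_col hσ.1 hS)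
  rw [prod_rayPointPlan_rpow hσ hβ ht hS] at hw
  have hC : 0 < ∏ i, (∑ w, x i w) ^ (∑ w, x i w) := by
    refine Finset.prod_pos fun i _ => ?_
    by_cases h : (σ i).val ≠ ℓ + 2 ∧ (σ (i + 1)).val ≠ ℓ + 2
    · have hb : (0 : ℝ) < β i := by exact_mod_cast hβ i h
      rw [hxdef, rayPointPlan_row hσ.1 ht i h]
      exact Real.rpow_pos_of_pos hb _
    · have h0 : ∑ w, x i w = 0 := Finset.sum_eq_zero fun w _ => rayPointPlan_of_infinite hσ.1 t i h w
      rw [h0, Real.rpow_zero]; exact one_pos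
  exact le_of_mul_le_mul_right hw hC

variable (σ α β) in
/-- **`M_σ(α,β) = F(t)` at a weighted scaling point** (the form used to certify exact growth constants of rays,
e.g. `bzSup a`). -/
theorem raySup_eq_of_isRayScaling (hσ : Function.Bijective σ) (hh : Homogeneous σ α β)
    (hray : ∀ N : ℤ, 0 ≤ N → BrownConvergent σ (fun i => N * α i) (fun i => N * β i))
    (hβ : ∀ i, ((σ i).val ≠ ℓ + 2 ∧ (σ (i + 1)).val ≠ ℓ + 2) → 0 < β i)
    {t : Fin ℓ → ℝ} (ht : t ∈ openSimplex ℓ) (hS : IsRayScaling σ α β hσ.1 t) :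
    raySup σ α β = rayF σ α β t :=
  (rayF_eq_raySup_of_isRayScaling σ α β hσ hh hray hβ ht hS).symm

end Summit.KontsevichZagierPeriods.Zeta5Search.Families.Cellular
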